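import Summits.RiemannHypothesis.RiemannHypothesis.Theorems.HandoffCouplingNearNull
import Literature.NumberTheory.LFunctions.WeilGroundEnergyParitySplit
import HarnessLib

/-!
# The LOSSY tier of the handoff logic, I: near-positivity tails and the regularised coupling law

Cell `rh-explicit`, TRACK «HANDOFF», seat handoff-theory-1 (definitions + logic), gen3.  Companion text:
`HOME/handoff/HANDOFF-STATEMENT.md` §J.  Builds on this seat's `HandoffCouplingCumulative.lean`,
`HandoffCouplingNearNull.lean`, `HandoffDecompositionConsequences.lean`, prove-2's `HandoffSchur.lean`, and the tree's
ground-energy API (`weilGroundEnergy`, `weilGroundEnergy_mul_le_re`, `le_weilGroundEnergy_of_forall`,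
`weilGroundEnergy_anti`, `weilGroundEnergy_nonneg_iff_holds`).

HONEST FRAMING.  Nothing here is a step towards RH.  The v1.5 classification (HANDOFF-STATEMENT §I.5) sorts every
per-window statement `X(q)` of the track into VACUOUS-in-the-tail or CUMULATIVE (`X(q) → IH(q)`), and leaves ONE slot
open: a QUANTITATIVE law.  This file types the simplest quantitative weakening of the Schur coupling law — the
REGULARISED law `CouplingReg(q, ℓ)`: `crossRe(u,h)² ≤ (Re Q(u) + ℓ‖u‖²)(Re Q(h) + ℓ‖h‖²)` (Cauchy–Schwarz with a
LOSS `ℓ ≥ 0`) — and settles its logical status: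
* §1 (third leg of the tail dichotomy, «LOSSY-CUMULATIVE»): if `X(q)` gives near-positivity of Weil's form on the
  old cone with a loss `c(q) → 0` (`X q → −c q ≤ ε((log q)/2)`, `ε = weilGroundEnergy`), then `X(q)` for INFINITELY
  MANY primes already implies RH (`riemannHypothesis_of_frequently_lossyCumulative`); file B's
  `riemannHypothesis_of_frequently_normBound` (`X = N(q)`, `c = cap`) is an instance
  (`HandoffNormBound.neg_handoffCap_le_weilGroundEnergy`); `RH ↔ limsup_t ε(t) ≥ 0`.
* §2: `CouplingReg(q, ℓ)` is RH-implied (`HandoffH.couplingReg`) and LOSSY-CUMULATIVE: tested against ONE edge function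
  of positive energy it gives `Re Q ≥ −ℓ‖·‖²` on the OLD cone, against one positive old-cone function the same on the
  edge layers, and the 2×2 Schur step then gives `Re Q ≥ −ℓ‖·‖²` on the whole NEW cone `C((log q⁺)/2)` OUTRIGHT — no
  induction hypothesis (`neg_le_weilGroundEnergy_new_of_handoffCouplingReg`).  Hence: with a loss schedule `ℓ(q) → 0`
  the tail form is RH (`riemannHypothesis_iff_exists_forall_handoffCouplingReg`, no discount); with a FIXED loss
  `ℓ > 0` it gives exactly «`ε(t) ≥ −ℓ` for all windows `t`», whose RH-status is the ONE analytic question this file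
  NAMES and does NOT answer: `WeilBottomBoundedCriterion` («`ε` bounded below ⟹ RH»; OPEN — heuristically an
  off-line zero drives `ε(t) → −∞` exponentially along dilated two-layer test functions, HANDOFF-STATEMENT §J.4).

References: Bombieri, Rend. Lincei (9) 11 (2000) §3–4, Thm 5 [Bombieri2000Weil]; Yoshida 1992 Thm 1
[Yoshida1992HermitianForms]; Suzuki 2026 Cor. 1.2 (λ_a = the Rayleigh bottom) [Suzuki2026]; this track: prove-2
ATTEMPT-2 (the Schur split), HANDOFF-STATEMENT §I–§J.
-/

set_option linter.dupNamespace false  -- the mandated namespace repeats `RiemannHypothesis`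

noncomputable section

open Set MeasureTheory Filter Metric Literature.NumberTheory.LFunctions
open scoped Topology

namespace Summit.RiemannHypothesis.RiemannHypothesis.Theorems.HandoffDecomposition

variable {q q' : ℕ} {η ℓ : ℝ}

/-! ## §1  Near-positivity with a loss, and the LOSSY-CUMULATIVE leg of the tail dichotomy -/

/-- For a window `a > 0`: `−ℓ ≤ ε(a)` iff `Re Q(g) ≥ −ℓ·‖g‖₂²` for every test function `g ∈ C(a)` (the ground
energy is the Rayleigh bottom; homogeneity). [cite: Bombieri2000Weil, §4 Problem 2; Suzuki2026 Cor. 1.2] -/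
theorem neg_le_weilGroundEnergy_iff {a ℓ : ℝ} (ha : 0 < a) :
    -ℓ ≤ weilGroundEnergy a ↔
      ∀ g : ℝ → ℂ, IsWeilTest g → tsupport g ⊆ Icc (-a) a →
        -ℓ * ∫ t : ℝ, ‖g t‖ ^ 2 ≤ (weilQuadratic g).re := by
  constructor
  · intro h g hg hs
    have hlow := ConnesVanSuijlekom.weilGroundEnergy_mul_le_re hg hs
    have hm : 0 ≤ ∫ t : ℝ, ‖g t‖ ^ 2 := integral_nonneg fun _ ↦ by positivity
    nlinarith [mul_le_mul_of_nonneg_right h hm]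
  · intro h
    refine le_weilGroundEnergy_of_forall ha fun g hg hs hn ↦ ?_
    have := h g hg hs
    rwa [hn, mul_one] at this

/-- **Near-positivity with every loss on some larger window gives positivity**: if for every `ε > 0` some window
`t ≥ a`, `t > 0`, has `ε(t) ≥ −ε`, then Weil positivity holds on `C(a)` (each `g ∈ C(a)` lies in every `C(t)`, and
`Re Q(g) ≥ −ε‖g‖²` for all `ε > 0`). [cite: Bombieri2000Weil, §4; this track (theory-1 gen3)] -/
theorem weilPositivityOn_of_forall_exists_neg_le_weilGroundEnergy {a : ℝ}
    (h : ∀ ε : ℝ, 0 < ε → ∃ t : ℝ, a ≤ t ∧ 0 < t ∧ -ε ≤ weilGroundEnergy t) : WeilPositivityOn a := by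
  intro g hg hs
  by_contra hneg
  obtain ⟨ε, hε, hεm⟩ := exists_pos_mul_lt (neg_pos.2 (not_le.1 hneg)) (∫ t : ℝ, ‖g t‖ ^ 2)
  obtain ⟨t, hat, ht, hεt⟩ := h ε hε
  have := (neg_le_weilGroundEnergy_iff ht).1 hεt g hg (hs.trans (Icc_subset_Icc (neg_le_neg hat) hat))
  linarith

/-- **`limsup_t ε(t) ≥ 0 ⟹ RH`**: if for every `ε > 0` ARBITRARILY LARGE windows have ground energy `≥ −ε`, the
Riemann hypothesis holds (the windows exhaust every cone; Weil's criterion in Yoshida's window form, `rung_R0`).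
[cite: Bombieri2000Weil, Thm. 2 and §4; this track (theory-1 gen3)] -/
theorem riemannHypothesis_of_frequently_nearPositive
    (h : ∀ ε : ℝ, 0 < ε → ∀ T : ℝ, ∃ t : ℝ, T ≤ t ∧ -ε ≤ weilGroundEnergy t) : Summit.RiemannHypothesis := by
  rw [MotivicDoor.Rungs.rung_R0]
  intro a ha
  refine weilPositivityOn_of_forall_exists_neg_le_weilGroundEnergy fun ε hε ↦ ?_
  obtain ⟨t, ht, hεt⟩ := h ε hε a
  exact ⟨t, ht, ha.trans_le ht, hεt⟩

/-- **`RH ↔ limsup_t ε(t) ≥ 0`** (`↔ ∀ t, ε(t) ≥ 0`): near-positivity with vanishing loss along ANY unbounded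
sequence of windows is already the Riemann hypothesis. [cite: Bombieri2000Weil, Thm. 2; this track (theory-1 gen3)] -/
theorem riemannHypothesis_iff_frequently_nearPositive :
    Summit.RiemannHypothesis ↔ ∀ ε : ℝ, 0 < ε → ∀ T : ℝ, ∃ t : ℝ, T ≤ t ∧ -ε ≤ weilGroundEnergy t := by
  refine ⟨fun hRH ε hε T ↦ ⟨max T 1, le_max_left _ _, ?_⟩, riemannHypothesis_of_frequently_nearPositive⟩
  have ht : (0 : ℝ) < max T 1 := lt_of_lt_of_le one_pos (le_max_right _ _)
  have h0 : 0 ≤ weilGroundEnergy (max T 1) :=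
    (weilGroundEnergy_nonneg_iff_holds ht).2 (MotivicDoor.Rungs.rung_R0.1 hRH _ ht)
  linarith

/-- `T ≤ (log q)/2` once `q ≥ ⌈e^{2T}⌉ + 1`. [folklore] -/
theorem le_log_half_of_ceil_exp_lt {T : ℝ} {q : ℕ} (hq : ⌈Real.exp (2 * T)⌉₊ + 1 ≤ q) : T ≤ Real.log q / 2 := by
  have h' : (⌈Real.exp (2 * T)⌉₊ : ℝ) + 1 ≤ q := by exact_mod_cast hq
  have h1 : Real.exp (2 * T) ≤ q := by linarith [Nat.le_ceil (Real.exp (2 * T))]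
  have h3 : 2 * T ≤ Real.log q := (Real.le_log_iff_exp_le (by linarith [Real.exp_pos (2 * T)])).2 h1
  linarith

/-- **THE LOSSY-CUMULATIVE LEG of the tail dichotomy** (third case next to `HandoffTailDichotomy.lean`'s VACUOUS /
CUMULATIVE): let `X(q)` be per-window statements such that `X(q)` gives near-positivity of Weil's form on the OLD
cone `C((log q)/2)` with a loss `c(q)`, and `c(q) → 0`.  Then `X(q)` for INFINITELY MANY primes `q` implies RH.
Instances: `X = N(q)` with `c = cap` (file B), `X = CouplingReg(q, ℓ q)` with `c = ℓ` (§2).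
[cite: Bombieri2000Weil, Thm. 2; this track (theory-1 gen3)] -/
theorem riemannHypothesis_of_frequently_lossyCumulative {X : ℕ → Prop} {c : ℕ → ℝ}
    (hX : ∀ q : ℕ, q.Prime → X q → -c q ≤ weilGroundEnergy (Real.log q / 2))
    (hc : Tendsto c atTop (𝓝 0)) (h : ∀ N : ℕ, ∃ q : ℕ, N ≤ q ∧ q.Prime ∧ X q) :
    Summit.RiemannHypothesis := by
  refine riemannHypothesis_of_frequently_nearPositive fun ε hε T ↦ ?_
  obtain ⟨N₁, hN₁⟩ := eventually_atTop.1 (hc.eventually (gt_mem_nhds hε))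
  obtain ⟨q, hq, hqp, hXq⟩ := h (max N₁ (⌈Real.exp (2 * T)⌉₊ + 1))
  refine ⟨Real.log q / 2, le_log_half_of_ceil_exp_lt ((le_max_right _ _).trans hq), ?_⟩
  have h1 := hX q hqp hXq
  have h2 := hN₁ q ((le_max_left _ _).trans hq)
  linarith

/-- **Tail form for lossy-cumulative statements**: if `X` is RH-implied and lossy-cumulative with vanishing loss,
`RH ↔ ∃ q₀, ∀ primes q ≥ q₀, X q` (`↔ ∀ q prime, X q`) — «for all large q» is NO discount for such `X` either.
[cite: Bombieri2000Weil, Thm. 2; this track (theory-1 gen3)] -/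
theorem riemannHypothesis_iff_exists_forall_of_lossyCumulative {X : ℕ → Prop} {c : ℕ → ℝ}
    (hRH : Summit.RiemannHypothesis → ∀ q : ℕ, q.Prime → X q)
    (hX : ∀ q : ℕ, q.Prime → X q → -c q ≤ weilGroundEnergy (Real.log q / 2))
    (hc : Tendsto c atTop (𝓝 0)) :
    Summit.RiemannHypothesis ↔ ∃ q₀ : ℕ, ∀ q : ℕ, q.Prime → q₀ ≤ q → X q := by
  refine ⟨fun h ↦ ⟨0, fun q hq _ ↦ hRH h q hq⟩, fun ⟨q₀, h⟩ ↦ ?_⟩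
  refine riemannHypothesis_of_frequently_lossyCumulative hX hc fun N ↦ ?_
  obtain ⟨q, hNq, hq⟩ := Nat.exists_infinite_primes (max N q₀)
  exact ⟨q, (le_max_left _ _).trans hNq, hq, h q hq ((le_max_right _ _).trans hNq)⟩

/-- File B's `N(q)` is lossy-cumulative with loss `cap(q) = (log q)/√q`: on `C((log q)/2)` the old form IS Weil's
form (`deficit_eq_of_narrow`), so `N(q)` gives `ε((log q)/2) ≥ −cap(q)`.  (`riemannHypothesis_of_frequently_normBound`
is thus the instance `X = N`, `c = cap` of `riemannHypothesis_of_frequently_lossyCumulative`.) [this track (theory-1 gen3); prove-1 ATTEMPT-1 Thm 2] -/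
theorem HandoffNormBound.neg_handoffCap_le_weilGroundEnergy (hq : q.Prime) (h : HandoffNormBound q) :
    -handoffCap q ≤ weilGroundEnergy (Real.log q / 2) := by
  have hpos : 0 < Real.log q / 2 := by
    have := Real.log_pos (show (1 : ℝ) < q by exact_mod_cast hq.one_lt); positivity
  rw [neg_le_weilGroundEnergy_iff hpos]
  intro g hg hs
  have hle : Real.log q / 2 ≤ Real.log (nextPrime q) / 2 := by
    have := Real.log_le_log (by exact_mod_cast hq.pos) (show (q : ℝ) ≤ nextPrime q by
      exact_mod_cast (lt_nextPrime q).le)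
    linarith
  have hd := h g hg (hs.trans (Icc_subset_Icc (neg_le_neg hle) hle))
  rw [deficit_eq_of_narrow hq hg hs] at hd
  unfold weilNorm2Sq at hd
  linarith

/-! ## §2  The REGULARISED coupling law (Cauchy–Schwarz with a loss `ℓ`) -/

/-- **`CouplingReg(q, q′, η, ℓ)`, the regularised (lossy) coupling law**: for every half-width `b ∈ I_q`, every
old-cone `u ∈ C((log q)/2)` and every edge-layer `h` (overlap `η`),
`crossRe(u,h)² ≤ (Re Q(u) + ℓ‖u‖₂²)·(Re Q(h) + ℓ‖h‖₂²)`.  For `ℓ = 0` this is prove-2's `HandoffCoupling`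
(`handoffCouplingReg_zero_iff`); for `ℓ > 0` it is the weakest natural QUANTITATIVE relaxation of it (near-null and
slightly negative old vectors may couple, but only within the budget `ℓ`).  RH-implied; a statement of THIS track
(HANDOFF-STATEMENT.md §J), not a literature fact. [this track (theory-1 gen3), HANDOFF-STATEMENT.md §J.2] -/
def HandoffCouplingReg (q q' : ℕ) (η ℓ : ℝ) : Prop :=
  ∀ b ∈ Icc (Real.log q / 2) (Real.log q' / 2), ∀ u h : ℝ → ℂ, IsWeilTest u →
    tsupport u ⊆ Icc (-(Real.log q / 2)) (Real.log q / 2) → Handoff.IsEdgeLayer q η b h →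
      (Handoff.crossRe u h) ^ 2 ≤
        ((weilQuadratic u).re + ℓ * ∫ t : ℝ, ‖u t‖ ^ 2) * ((weilQuadratic h).re + ℓ * ∫ t : ℝ, ‖h t‖ ^ 2)

/-- At zero loss the regularised law IS the coupling law. [this track (theory-1 gen3)] -/
theorem handoffCouplingReg_zero_iff : HandoffCouplingReg q q' η 0 ↔ Handoff.HandoffCoupling q q' η := by
  simp only [HandoffCouplingReg, Handoff.HandoffCoupling, zero_mul, add_zero]

/-- `Coupling → CouplingReg(ℓ)` for every `ℓ ≥ 0` (`2 ≤ q < q′`, `η ≥ 0`): the coupling law makes both energies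
non-negative (`weilPositivityOn_of_handoffCoupling`, `edgeNonneg_of_handoffCoupling`), and then the right-hand
side only grows with `ℓ`. [this track (theory-1 gen3)] -/
theorem handoffCouplingReg_of_handoffCoupling (hq : 2 ≤ q) (hqq' : q < q') (hη : 0 ≤ η) (hℓ : 0 ≤ ℓ)
    (hC : Handoff.HandoffCoupling q q' η) : HandoffCouplingReg q q' η ℓ := by
  intro b hb u h hu hus hh
  have hQu : 0 ≤ (weilQuadratic u).re :=
    weilPositivityOn_of_handoffCoupling (lt_of_lt_of_le (by norm_num) hq) hqq' hη hC u hu hus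
  have hQh : 0 ≤ (weilQuadratic h).re := edgeNonneg_of_handoffCoupling hq hC b hb h hh
  have hmu : 0 ≤ ∫ t : ℝ, ‖u t‖ ^ 2 := integral_nonneg fun _ ↦ by positivity
  have hmh : 0 ≤ ∫ t : ℝ, ‖h t‖ ^ 2 := integral_nonneg fun _ ↦ by positivity
  calc (Handoff.crossRe u h) ^ 2 ≤ (weilQuadratic u).re * (weilQuadratic h).re := hC b hb u h hu hus hh
    _ ≤ ((weilQuadratic u).re + ℓ * ∫ t : ℝ, ‖u t‖ ^ 2) * ((weilQuadratic h).re + ℓ * ∫ t : ℝ, ‖h t‖ ^ 2) :=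
      mul_le_mul (le_add_of_nonneg_right (by positivity)) (le_add_of_nonneg_right (by positivity)) hQh
        (by positivity)

/-- **RH-implied**: `H(q) → CouplingReg(q, q⁺, η, ℓ)` for a prime `q`, any `η ≥ 0`, `ℓ ≥ 0`. [this track (theory-1 gen3)] -/
theorem HandoffH.couplingReg (hq : q.Prime) (h : HandoffH q) (hη : 0 ≤ η) (hℓ : 0 ≤ ℓ) :
    HandoffCouplingReg q (nextPrime q) η ℓ :=
  handoffCouplingReg_of_handoffCoupling hq.two_le (lt_nextPrime q) hη hℓ
    (Handoff.handoffCoupling_of_weilPositivityOn hq.pos (lt_nextPrime q).le η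
      ((handoffH_iff_weilPositivityOn hq).1 h))

/-- **Lossy-cumulative on the OLD cone**: `CouplingReg(q, q′, η, ℓ)` (`0 < q < q′`, `η ≥ 0`, `ℓ ≥ 0`) gives
`Re Q(u) ≥ −ℓ‖u‖₂²` for every `u ∈ C((log q)/2)` — test the law against ONE edge-layer function of positive energy:
`0 ≤ crossRe² ≤ (Re Q(u) + ℓ‖u‖²)·(positive)`. [this track (theory-1 gen3); Bombieri2000Weil Thm. 12 (positive bumps)] -/
theorem neg_mul_le_re_weilQuadratic_old_of_handoffCouplingReg (hq : 0 < q) (hqq' : q < q') (hη : 0 ≤ η)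
    (hℓ : 0 ≤ ℓ) (hC : HandoffCouplingReg q q' η ℓ) {u : ℝ → ℂ} (hu : IsWeilTest u)
    (hus : tsupport u ⊆ Icc (-(Real.log q / 2)) (Real.log q / 2)) :
    -ℓ * ∫ t : ℝ, ‖u t‖ ^ 2 ≤ (weilQuadratic u).re := by
  obtain ⟨h, hh, hpos⟩ := exists_isEdgeLayer_re_weilQuadratic_pos hq hqq' hη
  have hq0 : (0 : ℝ) < q := by exact_mod_cast hq
  have hle : Real.log q / 2 ≤ Real.log q' / 2 := by
    have := Real.log_le_log hq0 (show (q : ℝ) ≤ q' by exact_mod_cast hqq'.le); linarith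
  have key := hC (Real.log q' / 2) ⟨hle, le_rfl⟩ u h hu hus hh
  have hmh : 0 ≤ ∫ t : ℝ, ‖h t‖ ^ 2 := integral_nonneg fun _ ↦ by positivity
  have hb : 0 < (weilQuadratic h).re + ℓ * ∫ t : ℝ, ‖h t‖ ^ 2 := by positivity
  by_contra hneg
  have ha : (weilQuadratic u).re + ℓ * ∫ t : ℝ, ‖u t‖ ^ 2 < 0 := by linarith [not_le.1 hneg]
  nlinarith [sq_nonneg (Handoff.crossRe u h), mul_neg_of_neg_of_pos ha hb]

/-- The same in ground-energy form: `CouplingReg(q, q′, η, ℓ) → ε((log q)/2) ≥ −ℓ` (`2 ≤ q < q′`). [this track (theory-1 gen3)] -/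
theorem neg_le_weilGroundEnergy_old_of_handoffCouplingReg (hq : 2 ≤ q) (hqq' : q < q') (hη : 0 ≤ η)
    (hℓ : 0 ≤ ℓ) (hC : HandoffCouplingReg q q' η ℓ) : -ℓ ≤ weilGroundEnergy (Real.log q / 2) := by
  have hpos : 0 < Real.log q / 2 := by
    have := Real.log_pos (show (1 : ℝ) < q by exact_mod_cast lt_of_lt_of_le (by norm_num) hq); positivity
  rw [neg_le_weilGroundEnergy_iff hpos]
  exact fun u hu hus ↦
    neg_mul_le_re_weilQuadratic_old_of_handoffCouplingReg (lt_of_lt_of_le (by norm_num) hq) hqq' hη hℓ hC hu hus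

/-- **Lossy-cumulative on the EDGE layers**: `CouplingReg(q, q′, η, ℓ)` (`q ≥ 2`, `ℓ ≥ 0`) gives
`Re Q(h) ≥ −ℓ‖h‖₂²` for every edge-layer `h` — test against ONE old-cone function of positive energy. [this track (theory-1 gen3)] -/
theorem neg_mul_le_re_weilQuadratic_edge_of_handoffCouplingReg (hq : 2 ≤ q) (hℓ : 0 ≤ ℓ)
    (hC : HandoffCouplingReg q q' η ℓ) {b : ℝ} (hb : b ∈ Icc (Real.log q / 2) (Real.log q' / 2))
    {h : ℝ → ℂ} (hh : Handoff.IsEdgeLayer q η b h) :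
    -ℓ * ∫ t : ℝ, ‖h t‖ ^ 2 ≤ (weilQuadratic h).re := by
  obtain ⟨u, hu, hus, hpos⟩ := exists_oldCone_re_weilQuadratic_pos hq
  have key := hC b hb u h hu hus hh
  have hmu : 0 ≤ ∫ t : ℝ, ‖u t‖ ^ 2 := integral_nonneg fun _ ↦ by positivity
  have ha : 0 < (weilQuadratic u).re + ℓ * ∫ t : ℝ, ‖u t‖ ^ 2 := by positivity
  by_contra hneg
  have hb' : (weilQuadratic h).re + ℓ * ∫ t : ℝ, ‖h t‖ ^ 2 < 0 := by linarith [not_le.1 hneg]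
  nlinarith [sq_nonneg (Handoff.crossRe u h), mul_neg_of_pos_of_neg ha hb']

/-- Mass splitting under a pointwise partition: if `‖u‖² + ‖h‖² ≤ ‖g‖²` pointwise (test functions), then
`‖u‖₂² + ‖h‖₂² ≤ ‖g‖₂²`. [folklore] -/
theorem integral_norm_sq_add_le {u h g : ℝ → ℂ} (hu : IsWeilTest u) (hh : IsWeilTest h) (hg : IsWeilTest g)
    (hpt : ∀ t : ℝ, ‖u t‖ ^ 2 + ‖h t‖ ^ 2 ≤ ‖g t‖ ^ 2) :
    (∫ t : ℝ, ‖u t‖ ^ 2) + ∫ t : ℝ, ‖h t‖ ^ 2 ≤ ∫ t : ℝ, ‖g t‖ ^ 2 := by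
  rw [← integral_add hu.integrable_norm_sq hh.integrable_norm_sq]
  exact integral_mono (hu.integrable_norm_sq.add hh.integrable_norm_sq) hg.integrable_norm_sq hpt

/-- **THE LOSSY SCHUR STEP — the regularised law ALONE gives near-positivity on the whole NEW cone**: for
`2 ≤ q < q′`, an overlap `0 < η < (log q)/2` and `ℓ ≥ 0`, `CouplingReg(q, q′, η, ℓ)` implies `Re Q(g) ≥ −ℓ‖g‖₂²` for
every `g ∈ C((log q′)/2)` — WITHOUT any induction hypothesis.  Split `g = u + h` by prove-2's bump (`u = χg` old-cone,
`h = (1−χ)g` edge-layer, `‖u‖₂² + ‖h‖₂² ≤ ‖g‖₂²`); `a := Re Q(u) + ℓ‖u‖² ≥ 0` and `c := Re Q(h) + ℓ‖h‖² ≥ 0` by the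
two previous lemmas, `crossRe² ≤ ac` by the law, so `a + c + 2·crossRe ≥ 0`. [this track (theory-1 gen3); prove-2 ATTEMPT-2 (Schur split)] -/
theorem neg_mul_le_re_weilQuadratic_new_of_handoffCouplingReg (hq : 2 ≤ q) (hqq' : q < q') (hη : 0 < η)
    (hη' : η < Real.log q / 2) (hℓ : 0 ≤ ℓ) (hC : HandoffCouplingReg q q' η ℓ) {g : ℝ → ℂ} (hg : IsWeilTest g)
    (hgs : tsupport g ⊆ Icc (-(Real.log q' / 2)) (Real.log q' / 2)) :
    -ℓ * ∫ t : ℝ, ‖g t‖ ^ 2 ≤ (weilQuadratic g).re := by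
  have hq0 : (0 : ℝ) < q := by exact_mod_cast lt_of_lt_of_le (by norm_num) hq
  have hbq : Real.log q / 2 ≤ Real.log q' / 2 := by
    have := Real.log_le_log hq0 (show (q : ℝ) ≤ q' by exact_mod_cast hqq'.le); linarith
  -- the bump (as in `Handoff.handoffH_of_coupling`)
  let χ : ContDiffBump (0 : ℝ) := ⟨Real.log q / 2 - η, Real.log q / 2, by linarith, by linarith⟩
  set u : ℝ → ℂ := fun x ↦ (χ x : ℂ) * g x with hu_def
  set h : ℝ → ℂ := fun x ↦ ((1 - χ x : ℝ) : ℂ) * g x with hh_def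
  have hsum : g = u + h := by
    funext x
    simp only [hu_def, hh_def, Pi.add_apply]
    push_cast
    ring
  have hu : IsWeilTest u :=
    ⟨(Complex.ofRealCLM.contDiff.comp χ.contDiff).mul hg.1, hg.2.mul_left⟩
  have hus : tsupport u ⊆ Icc (-(Real.log q / 2)) (Real.log q / 2) := by
    have hsub : Function.support u ⊆ ball (0 : ℝ) χ.rOut := by
      intro x hx
      by_contra hx'
      have hχ : χ x = 0 := by
        have hxs : x ∉ Function.support (χ : ℝ → ℝ) := by rw [χ.support_eq]; exact hx'
        simpa [Function.mem_support] using hxs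
      exact hx (by simp [hu_def, hχ])
    have h1 : tsupport u ⊆ closedBall (0 : ℝ) χ.rOut :=
      (closure_mono hsub).trans closure_ball_subset_closedBall
    intro x hx
    have := h1 hx
    rw [Real.closedBall_eq_Icc] at this
    simpa using this
  have hhW : IsWeilTest h :=
    ⟨(Complex.ofRealCLM.contDiff.comp (contDiff_const.sub χ.contDiff)).mul hg.1, hg.2.mul_left⟩
  have hh : Handoff.IsEdgeLayer q η (Real.log q' / 2) h := by
    refine ⟨hhW, tsupport_mul_subset_right.trans hgs, ?_⟩
    intro x hx
    have hχ : χ x = 1 := χ.one_of_mem_closedBall (by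
      rw [mem_closedBall, dist_zero_right, Real.norm_eq_abs]
      exact hx.le)
    simp [hh_def, hχ]
  -- masses
  have hmass : (∫ t : ℝ, ‖u t‖ ^ 2) + ∫ t : ℝ, ‖h t‖ ^ 2 ≤ ∫ t : ℝ, ‖g t‖ ^ 2 := by
    refine integral_norm_sq_add_le hu hhW hg fun t ↦ ?_
    have h0 : 0 ≤ χ t := χ.nonneg
    have h1 : χ t ≤ 1 := χ.le_one
    have eu : ‖u t‖ ^ 2 = (χ t) ^ 2 * ‖g t‖ ^ 2 := by
      simp only [hu_def, norm_mul, Complex.norm_real, Real.norm_eq_abs, abs_of_nonneg h0]; ring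
    have eh : ‖h t‖ ^ 2 = (1 - χ t) ^ 2 * ‖g t‖ ^ 2 := by
      simp only [hh_def, norm_mul, Complex.norm_real, Real.norm_eq_abs, abs_of_nonneg (sub_nonneg.2 h1)]
      ring
    rw [eu, eh]
    nlinarith [sq_nonneg ‖g t‖, mul_nonneg h0 (sub_nonneg.2 h1)]
  -- the three blocks
  have ha : 0 ≤ (weilQuadratic u).re + ℓ * ∫ t : ℝ, ‖u t‖ ^ 2 := by
    have := neg_mul_le_re_weilQuadratic_old_of_handoffCouplingReg (lt_of_lt_of_le (by norm_num) hq) hqq'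
      hη.le hℓ hC hu hus
    linarith
  have hc : 0 ≤ (weilQuadratic h).re + ℓ * ∫ t : ℝ, ‖h t‖ ^ 2 := by
    have := neg_mul_le_re_weilQuadratic_edge_of_handoffCouplingReg hq hℓ hC ⟨hbq, le_rfl⟩ hh
    linarith
  have hb := hC (Real.log q' / 2) ⟨hbq, le_rfl⟩ u h hu hus hh
  have hschur := Handoff.add_add_two_mul_nonneg_of_sq_le ha hc hb
  have hmu : 0 ≤ ∫ t : ℝ, ‖u t‖ ^ 2 := integral_nonneg fun _ ↦ by positivity
  have hmh : 0 ≤ ∫ t : ℝ, ‖h t‖ ^ 2 := integral_nonneg fun _ ↦ by positivity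
  have hQ : (weilQuadratic g).re = (weilQuadratic u).re + (weilQuadratic h).re + 2 * Handoff.crossRe u h := by
    rw [hsum, Handoff.re_weilQuadratic_add]
  rw [hQ]
  nlinarith [mul_le_mul_of_nonneg_left hmass hℓ]

/-- The same in ground-energy form: `CouplingReg(q, q′, η, ℓ) → ε((log q′)/2) ≥ −ℓ`. [this track (theory-1 gen3)] -/
theorem neg_le_weilGroundEnergy_new_of_handoffCouplingReg (hq : 2 ≤ q) (hqq' : q < q') (hη : 0 < η)
    (hη' : η < Real.log q / 2) (hℓ : 0 ≤ ℓ) (hC : HandoffCouplingReg q q' η ℓ) :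
    -ℓ ≤ weilGroundEnergy (Real.log q' / 2) := by
  have hpos : 0 < Real.log q' / 2 := by
    have := Real.log_pos (show (1 : ℝ) < q' by exact_mod_cast lt_of_lt_of_le (by omega) hqq'); positivity
  rw [neg_le_weilGroundEnergy_iff hpos]
  exact fun g hg hgs ↦ neg_mul_le_re_weilQuadratic_new_of_handoffCouplingReg hq hqq' hη hη' hℓ hC hg hgs

/-- **SANDWICH with loss** at a prime `q` (overlap `0 < η < (log q)/2`, loss `ℓ ≥ 0`):
`H(q) → CouplingReg(q, q⁺, η, ℓ) → (ε((log q⁺)/2) ≥ −ℓ ∧ ε((log q)/2) ≥ −ℓ)`.  At `ℓ = 0` both ends coincide with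
`H(q)` (`handoffCoupling_iff_handoffH`); for `ℓ > 0` the law sits between positivity and near-positivity of the
SAME window. [this track (theory-1 gen3)] -/
theorem handoffCouplingReg_sandwich (hq : q.Prime) (hη : 0 < η) (hη' : η < Real.log q / 2) (hℓ : 0 ≤ ℓ) :
    (HandoffH q → HandoffCouplingReg q (nextPrime q) η ℓ) ∧
      (HandoffCouplingReg q (nextPrime q) η ℓ →
        -ℓ ≤ weilGroundEnergy (Real.log (nextPrime q) / 2) ∧ -ℓ ≤ weilGroundEnergy (Real.log q / 2)) :=
  ⟨fun h ↦ h.couplingReg hq hη.le hℓ, fun hC ↦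
    ⟨neg_le_weilGroundEnergy_new_of_handoffCouplingReg hq.two_le (lt_nextPrime q) hη hη' hℓ hC,
      neg_le_weilGroundEnergy_old_of_handoffCouplingReg hq.two_le (lt_nextPrime q) hη.le hℓ hC⟩⟩

/-- **VANISHING LOSS IS NO DISCOUNT**: for any overlap schedule `η_q ≥ 0` and any loss schedule `ℓ_q ≥ 0` with
`ℓ_q → 0`, `RH ↔ ∃ q₀, ∀ primes q ≥ q₀, CouplingReg(q, q⁺, η_q, ℓ_q)` (`↔ ∀ q prime, …`).
[cite: Bombieri2000Weil, Thm. 2; this track (theory-1 gen3)] -/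
theorem riemannHypothesis_iff_exists_forall_handoffCouplingReg {η ℓ : ℕ → ℝ}
    (hη : ∀ q : ℕ, q.Prime → 0 ≤ η q) (hℓ : ∀ q : ℕ, q.Prime → 0 ≤ ℓ q) (hℓ0 : Tendsto ℓ atTop (𝓝 0)) :
    Summit.RiemannHypothesis ↔
      ∃ q₀ : ℕ, ∀ q : ℕ, q.Prime → q₀ ≤ q → HandoffCouplingReg q (nextPrime q) (η q) (ℓ q) :=
  riemannHypothesis_iff_exists_forall_of_lossyCumulative
    (fun hRH q hq ↦ (handoffH_of_riemannHypothesis hRH hq).couplingReg hq (hη q hq) (hℓ q hq))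
    (fun q hq hC ↦ neg_le_weilGroundEnergy_old_of_handoffCouplingReg hq.two_le (lt_nextPrime q) (hη q hq)
      (hℓ q hq) hC) hℓ0

/-- **FIXED LOSS gives exactly «the window bottom is bounded below»**: if `CouplingReg(q, q⁺, η_q, ℓ)` holds for all
primes `q ≥ q₀` with ONE loss `ℓ ≥ 0`, then `ε(t) ≥ −ℓ` on EVERY window `t > 0` (every window lies below some large
prime; `ε` is antitone). [this track (theory-1 gen3); Bombieri2000Weil §4 Thm. 5 (monotonicity)] -/
theorem neg_le_weilGroundEnergy_of_forall_handoffCouplingReg {η : ℕ → ℝ} {q₀ : ℕ}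
    (hη : ∀ q : ℕ, q.Prime → 0 ≤ η q) (hℓ : 0 ≤ ℓ)
    (h : ∀ q : ℕ, q.Prime → q₀ ≤ q → HandoffCouplingReg q (nextPrime q) (η q) ℓ) {t : ℝ} (ht : 0 < t) :
    -ℓ ≤ weilGroundEnergy t := by
  obtain ⟨q, hq, hqp⟩ := Nat.exists_infinite_primes (max q₀ (⌈Real.exp (2 * t)⌉₊ + 1))
  have hold := neg_le_weilGroundEnergy_old_of_handoffCouplingReg hqp.two_le (lt_nextPrime q) (hη q hqp) hℓ
    (h q hqp ((le_max_left _ _).trans hq))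
  exact hold.trans (weilGroundEnergy_anti ht (le_log_half_of_ceil_exp_lt ((le_max_right _ _).trans hq)))

/-- **THE OPEN ANALYTIC LEMMA, NAMED (not claimed)**: `WeilBottomBoundedCriterion` := «a UNIFORM lower bound
`ε(t) ≥ −C` on the window bottom of Weil's form over all windows `t > 0` implies the Riemann hypothesis».  Equivalently
(`weilBottomBoundedCriterion_iff`) `RH ↔ ∃ C, ∀ t > 0, −C ≤ ε(t)`.  STATUS: OPEN; a question of THIS track, NOT a
literature fact (presearch: corpus + galaxy, none).  Heuristic FOR it (HANDOFF-STATEMENT §J.4, ARGUED for finitely many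
off-line zeros): an off-line zero `ρ₀ = ½ + δ + iγ₀` tested by dilated antisymmetric two-layer pairs
`λ^{−1/2}(φ₊ − φ₋)(x/λ)e^{−iγ₀x}` drives `Re Q/‖·‖² ≲ −λe^{2λδT}` along a density-one set of `λ`.  It is the bridge that
would make every FIXED-LOSS / bounded-loss law of this file and of `HandoffLossyStep.lean` RH-strength in the tail.
[this track (theory-1 gen3), HANDOFF-STATEMENT.md §J.4 — OPEN] -/
def WeilBottomBoundedCriterion : Prop :=
  (∃ C : ℝ, ∀ t : ℝ, 0 < t → -C ≤ weilGroundEnergy t) → Summit.RiemannHypothesis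

/-- `WeilBottomBoundedCriterion ↔ (RH ↔ the window bottom is bounded below)` — the converse half is free
(under RH, `ε ≥ 0`). [this track (theory-1 gen3)] -/
theorem weilBottomBoundedCriterion_iff :
    WeilBottomBoundedCriterion ↔
      (Summit.RiemannHypothesis ↔ ∃ C : ℝ, ∀ t : ℝ, 0 < t → -C ≤ weilGroundEnergy t) := by
  refine ⟨fun h ↦ ⟨fun hRH ↦ ⟨0, fun t ht ↦ ?_⟩, h⟩, fun h ↦ h.2⟩
  have := (weilGroundEnergy_nonneg_iff_holds ht).2 (MotivicDoor.Rungs.rung_R0.1 hRH t ht)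
  linarith

/-- **CONDITIONAL**: granted `WeilBottomBoundedCriterion`, the regularised coupling law with ANY fixed loss `ℓ ≥ 0`
for all primes `q ≥ q₀` implies RH.  (Unconditionally it gives only `ε ≥ −ℓ` everywhere.) [this track (theory-1 gen3) — conditional on the OPEN criterion] -/
theorem riemannHypothesis_of_forall_handoffCouplingReg_const (hL : WeilBottomBoundedCriterion) {η : ℕ → ℝ}
    {q₀ : ℕ} (hη : ∀ q : ℕ, q.Prime → 0 ≤ η q) (hℓ : 0 ≤ ℓ)
    (h : ∀ q : ℕ, q.Prime → q₀ ≤ q → HandoffCouplingReg q (nextPrime q) (η q) ℓ) : Summit.RiemannHypothesis :=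
  hL ⟨ℓ, fun _ ht ↦ neg_le_weilGroundEnergy_of_forall_handoffCouplingReg hη hℓ h ht⟩

end Summit.RiemannHypothesis.RiemannHypothesis.Theorems.HandoffDecomposition

end
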